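import Summits.CriticalPhenomena.PercolationContinuityZ3.Theorems.PercNearOneGluingNoHeavyConstsMDLXJointXEdgeInduction
import Summits.CriticalPhenomena.PercolationContinuityZ3.Theorems.PercNearOneGluingNoHeavyConstsMDLXJointMarkerLattice
import HarnessLib

/-!
# CROSS: the middle-slot polarised margin `P(X, X∪{u}, X)` is nonnegative on MDL(X)′ graphs, for EVERY added vertex `u`
# (PAPER-2 track (ii), seat `prim-consts-2`, gen 20)

builds on p205010 (kernel theorem, internal audit signed; external expert review pending).  Support file (`--supports
stmt-CriticalPhenomena-4575`); one theorem, no sorries, standard axioms.  Memo `run/shared/lean/prim/consts/FROM-prim-consts-2-g20-AVOID-SPLIT.md` §0(5c).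

`Consts.CrossRel` (…`XEdgeInduction.lean`) asks that `M₁ = P(X',X,X) + P(X,X',X) + P(X,X,X') ≥ 0` and `M₂ = P(X',X',X) + P(X',X,X') + P(X,X',X') ≥ 0`
(`X' = X ∪ {u}`, `P = Consts.polMargin`, slots = (copy-0 = `T/T∩W`-copy, copy-1 = plain copy, copy-2 = `Z/Y`-copy)) on graphs where MDL(X)′ holds.
THIS FILE signs one of the six off-diagonal terms for every `u`:
* `Consts.polMargin_middle_nonneg` — **`P(X, X∪{u}, X) ≥ 0` whenever `P(X,X,X) ≥ 0`** (the MDL(X)′ margin at the same data), by the identity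
  `μ(D)·P(X,X',X) = μ(D')·P(X,X,X) + [μ(D')∫_D F − μ(D)∫_{D'} F]·[μ(T)μ(D∩Z) − μ(T∩W)μ(D∩Y)]` (`D' = D ∩ {s ↮ u}`), whose last two factors are
  `≥ 0` by van den Berg–Häggström–Kahn Thm 1.3 (`F(C_s)` and `1{s↔u}` are positively correlated given `s↮X`; `Consts.covD_conn_nonneg`) and by the marker-reach
  inequality `Consts.mdlx_marker_reach_le` (`ν(Z) ≥ p'ν(Y)`).
So `M₁ ≥ P(X',X,X) + P(X,X,X')` remains to be signed.  Numerics (this seat, exact, all up-sets, corner weights, 2 243 instances n ≤ 6 incl. 660 with `u = z`):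
`P(X,X',X)` 0 violations (this theorem); `P(X',X',X)`, `P(X',X',X)+P(X,X',X')`, `P(X',X',X)+P(X',X,X')` 0 violations (candidates, NOT proved);
`P(X',X,X)` 15, `P(X,X,X')` 1 659, `P(X',X,X')` 927, `P(X,X',X')` 969, `P(X',X,X)+P(X,X,X')` 599 violations (at `u = z`: `P(X',X,X)`, `P(X',X,X')` 0/660).
[cite: VandenbergHaggstromKahn2005, Thm. 1.3 (p. 6), Thm. 1.4 (p. 7), §2.1 (pp. 9–13)]
-/

noncomputable section

namespace Summit.CriticalPhenomena.PercolationContinuityZ3.Theorems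

open MeasureTheory Set Literature.Probability.LatticeModels Literature.Probability.Percolation
open scoped Classical

namespace Consts

variable {V : Type*} [Fintype V]

/-- **The middle-slot CROSS term is nonnegative on MDL(X)′ data.**  For `s ∉ X`, any `u`, monotone `F`: if `P(X,X,X) ≥ 0` (the `Consts.MDLXJoint`
margin at `(w,s,y,z,X,F)`), then `P(X, X∪{u}, X) ≥ 0`.  Identity `μ(D)·P(X,X',X) = μ(D')·P(X,X,X) + [μ(D')∫_D F − μ(D)∫_{D'}F]·[μ(T)μ(D∩Z) − μ(T∩W)μ(D∩Y)]`.
[cite: VandenbergHaggstromKahn2005, Thm. 1.3 (p. 6), §2.1 (pp. 9–13)] -/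
theorem polMargin_middle_nonneg (w : Sym2 V → unitInterval) (s y z u : V) (X : Set V) (hs : s ∉ X)
    (F : Set (Sym2 V) → ℝ) (hF : Monotone F) (hIH : 0 ≤ polMargin (prodBernoulli w) s y z F X X X) :
    0 ≤ polMargin (prodBernoulli w) s y z F X (insert u X) X := by
  classical
  set μ := prodBernoulli w with hμ
  have hmeas : ∀ S : Set (BondConfig V), MeasurableSet S := fun _ => MeasurableSet.of_discrete
  set D : Set (BondConfig V) := {ω | ∀ x ∈ X, ¬ (openGraph ω).Reachable s x} with hD
  set D' : Set (BondConfig V) := {ω | ∀ x ∈ insert u X, ¬ (openGraph ω).Reachable s x} with hD'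
  set A : Set (BondConfig V) := {ω | ∀ x ∈ insert s X, ¬ (openGraph ω).Reachable y x} with hA
  set Yv : Set (BondConfig V) := openConn s y with hYv
  set Zv : Set (BondConfig V) := openConn s z with hZv
  set Uv : Set (BondConfig V) := openConn s u with hUv
  have hD'eq : D' = D \ Uv := by
    ext ω; simp only [hD', hD, hUv, mem_setOf_eq, forall_mem_insert, mem_sdiff, openConn]; tauto
  -- quantities
  set t := μ.real (A ∩ D) with ht
  set tw := μ.real (A ∩ D ∩ openConn y z) with htw
  set d := μ.real D with hd
  set d' := μ.real D' with hd'
  set dz := μ.real (D ∩ Zv) with hdz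
  set dy := μ.real (D ∩ Yv) with hdy
  set f := ∫ ω in D, F (openEdgeCluster ω s) ∂μ with hf
  set f' := ∫ ω in D', F (openEdgeCluster ω s) ∂μ with hf'
  set fz := ∫ ω in D ∩ Zv, F (openEdgeCluster ω s) ∂μ with hfz
  set fy := ∫ ω in D ∩ Yv, F (openEdgeCluster ω s) ∂μ with hfy
  -- `d' f − d f' ≥ 0`: vdBHK Thm 1.3 for `F` and `1{s ↔ u}` given `s ↮ X`
  have hdu : μ.real (D ∩ Uv) = d - d' := by
    have h := measureReal_inter_add_sdiff (μ := μ) (s := D) (hmeas Uv)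
    rw [hd', hD'eq]; linarith
  have hfu : ∫ ω in D ∩ Uv, F (openEdgeCluster ω s) ∂μ = f - f' := by
    have h := integral_inter_add_sdiff (μ := μ) (s := D) (hmeas Uv) ((Integrable.of_finite (f := fun ω => F (openEdgeCluster ω s))).integrableOn)
    rw [hf', hD'eq]; linarith
  have hδ : 0 ≤ d' * f - d * f' := by
    have h := covD_conn_nonneg w s X hs F hF u
    unfold CSH.covD at h
    change 0 ≤ d * (∫ ω in D ∩ Uv, F (openEdgeCluster ω s) ∂μ) - f * μ.real (D ∩ Uv) at h
    rw [hdu, hfu] at h; linarith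
  -- marker reach: `t dz ≥ tw dy`
  have hR : tw * dy ≤ t * dz := by
    have h := mdlx_marker_reach_le w s y z X
    change tw * dy ≤ t * dz at h; exact h
  have hM : 0 ≤ t * (d * fz - f * dz) - tw * (d * fy - f * dy) := by
    have h := hIH; unfold polMargin at h; exact h
  have hd0 : 0 ≤ d := measureReal_nonneg
  have hd'0 : 0 ≤ d' := measureReal_nonneg
  have hd'le : d' ≤ d := measureReal_mono (by rw [hD'eq]; exact Set.sdiff_subset)
  unfold polMargin
  change 0 ≤ t * (d' * fz - f' * dz) - tw * (d' * fy - f' * dy)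
  -- `d · P(X,X',X) = d' · P(X,X,X) + (d'f − d f')(t dz − tw dy)`
  have key : d * (t * (d' * fz - f' * dz) - tw * (d' * fy - f' * dy)) =
      d' * (t * (d * fz - f * dz) - tw * (d * fy - f * dy)) + (d' * f - d * f') * (t * dz - tw * dy) := by ring
  by_cases hdz0 : d = 0
  · -- `D` null: everything vanishes
    have hd'z : d' = 0 := le_antisymm (hdz0 ▸ hd'le) hd'0
    have hDnull : μ D = 0 := (measureReal_eq_zero_iff (measure_ne_top μ _)).1 hdz0
    have hD'null : μ D' = 0 := (measureReal_eq_zero_iff (measure_ne_top μ _)).1 hd'z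
    have hf'0 : f' = 0 := setIntegral_measure_zero _ hD'null
    have hfz0 : fz = 0 := setIntegral_measure_zero _ (measure_mono_null inter_subset_left hDnull)
    have hfy0 : fy = 0 := setIntegral_measure_zero _ (measure_mono_null inter_subset_left hDnull)
    rw [hd'z, hf'0, hfz0, hfy0]; simp
  have hdpos : 0 < d := lt_of_le_of_ne hd0 (Ne.symm hdz0)
  have hprod : 0 ≤ d * (t * (d' * fz - f' * dz) - tw * (d' * fy - f' * dy)) := by
    rw [key]
    exact add_nonneg (mul_nonneg hd'0 hM) (mul_nonneg hδ (by linarith))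
  exact (mul_nonneg_iff_of_pos_left hdpos).1 hprod

end Consts

end Summit.CriticalPhenomena.PercolationContinuityZ3.Theorems

end
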